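import Literature.AnabelianGeometry.EtaleTheta.ThetaRigidityToyLevelThree
import Literature.AnabelianGeometry.EtaleTheta.ThetaRigiditySchemaWitness
import Literature.AnabelianGeometry.EtaleTheta.ThetaRigidityLevels
import Literature.AnabelianGeometry.EtaleTheta.Discharge.Sec2RigidityProofs
import HarnessLib

/-!
# [EtTh] Cor. 2.18 (iv) over a bare `ThetaEnvData` (FACT rows F-0638 / F-0639): the universal closures
# are REFUTED, and each clause HOLDS UNCONDITIONALLY at an explicit inhabitant (proof-only)

S. Mochizuki, *The Étale Theta Function and its Frobenioid-theoretic Manifestations* [EtTh], Publ. RIMS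
**45** (2009), §2, Cor. 2.18 (iv) "Lifting Isomorphisms", PRIMS text pp. 61–63 (locators `p.N` = PDF
pages; bib key `MochizukiEtTh2009`): "every automorphism of the topological group `Π^tp_X` lifts to an
automorphism of the model mono-theta environment" (surjectivity) and "the automorphisms inducing the
identity on `Π^tp_Y` are, up to `μ_N`-conjugacy, the twists by `Hom(Π•_Y/Π•_Ÿ, Ker(Π• ↠ Π•_Y))`"
(fibres).

`ThetaRigidityLevels.lean` (abc-iut-L2-t2) restates the two `RigidData`-level named facts VERBATIM over a
bare `T : ThetaEnvData N` — `ThetaEnvData.Cor218_iv_fibre` (F-0638) and `ThetaEnvData.Cor218_iv_surjective`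
(F-0639) — and proves `RigidData.cor218_iv_fibre_iff` / `…_surjective_iff` (`Iff.rfl`).  This PROOF-ONLY
file (no `def`, no instance, no new named fact) records the kernel status of both rows for the cell's
FROZEN FACT-LIST (tranche 151):

* `ThetaEnvData.not_forall_cor218_iv_fibre`, `ThetaEnvData.not_forall_cor218_iv_surjective` — the
  universal closures `∀ N (T : ThetaEnvData N), …` are FALSE: one-line transports of abc-iut-w5-d175's
  `RigidData.ToyN3.not_forall_cor218_iv_fibre` (level-`3` toy, `flipEnv` inverts the cyclotome) and
  `RigidData.Toy.not_forall_cor218_iv_surjective` (level-`1` toy, `id × swap` moves `Π^tp_Ÿ`).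
* UNCONDITIONAL INSTANCE FORMS (new): `RigidData.Toy.cor218_iv_fibre l : (Toy.toy l).Cor218_iv_fibre` — at
  level `N = 1` the envelope is `Π^tp_Y` itself, so an automorphism over the identity of `Π^tp_Y` IS the
  identity, i.e. the `μ_1`-conjugate (by `1`) of the twist by `φ = 1`; and
  `RigidData.ToyN3.cor218_iv_surjective : ToyN3.toy.Cor218_iv_surjective` — in `Π^tp_X = ℤ × (ℤ/2 × ℤ/3)`
  the subgroup `Π^tp_Ÿ = 0 × 0 × ℤ/3` is the `3`-torsion of `Π^tp_Y`, hence stable under every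
  automorphism `γ` preserving `Π^tp_Y`; `γ` acts on it through some `ψ_γ ∈ Aut(μ_3)` and
  `(u, y) ↦ (ψ_γ u, γ y)` is an automorphism of the model mono-theta environment lying over `γ|_{Π^tp_Y}`
  (`exists_iso_over`, all constructions inlined).  Hence both typed clauses are SATISFIABLE, and
  F-0624 / F-0625 (the `RigidData` rows) acquire an instance-PROVED witness too.
* `ThetaEnvData.exists_cor218_iv_fibre` / `…_surjective` and the two `…_schema_verdict`s — the shape the
  FACT-LIST renderer's «universal-closure REFUTED; instance form PROVED» label describes.

The instance forms AT THE [EtTh] §1 MODEL are lane C2's (cited, not restated):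
`DoubleUnderline.thetaEnvData_cor218_iv_surjective_modAll` / `thetaEnvData_cor218_iv_fibre_of_origin`
(`Discharge/Sec2Cor218ivAllLevels.lean`), conditional on the named inputs listed there.

HONEST FRAMING: statements about the cell's own typing of a refereed pre-IUT corollary over an abstract
interface and about two explicit toys of that interface — print's Cor. 2.18 (iv) concerns the tempered
fundamental group of a specific curve and is neither refuted nor proved here; nothing here bears on
[IUTchIII] Cor. 3.12 or takes a side; typed ≠ proved.  Written by the cell `abc-iut` (seat abc-iut-f-151).
-/

namespace Literature.AnabelianGeometry.EtaleTheta

/-! ## §0. A bookkeeping lemma on subgroups stable under a group automorphism -/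

/-- If an automorphism `e` of a group maps a subgroup `H` ONTO itself, so does `e⁻¹`.
[cite: MochizukiEtTh2009, Cor 2.18(i) p.60] -/
theorem Subgroup.map_symm_eq_self_of_map_eq_self {G : Type*} [Group G] (e : G ≃* G) (H : Subgroup G)
    (h : H.map e.toMonoidHom = H) : H.map e.symm.toMonoidHom = H := by
  ext y
  constructor
  · rintro ⟨x, hx, rfl⟩
    have hx' : x ∈ H.map e.toMonoidHom := h.symm ▸ hx
    obtain ⟨w, hw, rfl⟩ := hx'
    simpa using hw
  · intro hy
    exact ⟨e y, h.le ⟨y, hy, rfl⟩, by simp⟩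

namespace RigidData

/-! ## §1. Level `N = 1`: the fibre clause HOLDS at `RigidData.Toy.toy l` (F-0624 / F-0638 instance) -/

namespace Toy

/-- **Cor. 2.18 (iv), fibres, HOLDS at the level-`1` toy** (every `l`): with `μ_1 = 1` an element of the
envelope `Π^tp_Y[μ_1]` is determined by its image in `Π^tp_Y`, so an automorphism of the model inducing the
identity on `Π^tp_Y` is the identity — the `μ_1`-conjugate by `c = 1` of the twist by `φ = 1`; the
converse clause is abc-iut-L2-t10's `ThetaEnvData.exists_iso_eq_twist` (every interface instance).
[cite: MochizukiEtTh2009, Cor 2.18(iv) p.61] -/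
theorem cor218_iv_fibre (l : ℕ) :
    Literature.AnabelianGeometry.EtaleTheta.RigidData.Cor218_iv_fibre (toy l) := by
  intro η hη
  refine ⟨fun α hα => ?_, fun φ hφ => (toy l).toThetaEnvData.exists_iso_eq_twist hη φ hφ⟩
  refine ⟨1, fun _ => rfl, 1, fun x => ?_⟩
  have h1 : (α.e x).right = x.right := hα x
  refine SemidirectProduct.ext (Subsingleton.elim _ _) ?_
  rw [h1, MulAut.conj_apply]
  simp

end Toy

/-! ## §2. Level `N = 3`: the surjectivity clause HOLDS at `RigidData.ToyN3.toy` (F-0625 / F-0639 instance) -/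

namespace ToyN3

open RigidData.Toy (M2)

/-- `(0, (0, t)) ∈ Π^tp_Ÿ` (the inclusion `t ↦ (0, (0, t))` of the `ℤ/3`-coordinate is
`(MonoidHom.inr _ K3).comp (MonoidHom.inr M2 M3)`). [cite: MochizukiEtTh2009, Def 2.13 p.47] -/
theorem inr_inr_mem_PiYdd (t : M3) :
    (MonoidHom.inr (Multiplicative ℤ) K3).comp (MonoidHom.inr M2 M3) t ∈ PiYdd :=
  (mem_PiYdd_iff _ _ _).mpr ⟨rfl, rfl⟩

/-- An element of `Π^tp_Ÿ = 0 × 0 × ℤ/3` IS its `ℤ/3`-coordinate. [cite: MochizukiEtTh2009, Def 2.13 p.47] -/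
theorem inr_inr_q3_of_mem {x : P3} (hx : x ∈ PiYdd) :
    (MonoidHom.inr (Multiplicative ℤ) K3).comp (MonoidHom.inr M2 M3) (q3 x) = x := by
  obtain ⟨z, a, t⟩ := x
  obtain ⟨rfl, rfl⟩ := (mem_PiYdd_iff z a t).mp hx
  rfl

/-- In `ℤ/2`, a cube is trivial only if the element is. [cite: MochizukiEtTh2009, Def 2.13 p.47] -/
theorem M2.pow_three_eq_one_iff (a : M2) : a ^ 3 = 1 ↔ a = 1 := by
  revert a
  decide

/-- **`Π^tp_Ÿ` is the `3`-torsion of `Π^tp_Y`** in the level-`3` toy (so it is characteristic).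
[cite: MochizukiEtTh2009, Cor 2.18(i) p.60] -/
theorem mem_PiYdd_iff_mem_PiY_and_pow_three (x : P3) : x ∈ PiYdd ↔ x ∈ PiY ∧ x ^ 3 = 1 := by
  obtain ⟨z, a, t⟩ := x
  rw [mem_PiYdd_iff, mem_PiY_iff]
  constructor
  · rintro ⟨rfl, rfl⟩
    refine ⟨rfl, ?_⟩
    ext
    · rfl
    · rfl
    · exact pow_three_eq_one t
  · rintro ⟨rfl, h⟩
    have ha : a ^ 3 = 1 := by simpa using congrArg (fun p : P3 => p.2.1) h
    exact ⟨(M2.pow_three_eq_one_iff a).mp ha, rfl⟩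

/-- An automorphism of `Π^tp_X` preserving `Π^tp_Y` maps `Π^tp_Ÿ` into `Π^tp_Ÿ`.
[cite: MochizukiEtTh2009, Cor 2.18(i) p.60] -/
theorem apply_mem_PiYdd (e : P3 ≃* P3) (h : PiY.map e.toMonoidHom = PiY) {x : P3} (hx : x ∈ PiYdd) :
    e x ∈ PiYdd := by
  rw [mem_PiYdd_iff_mem_PiY_and_pow_three] at hx ⊢
  exact ⟨h.le ⟨x, hx.1, rfl⟩, by rw [← map_pow, hx.2, map_one]⟩

/-- The coefficient endomorphism `ψ_e : t ↦ q₃(e(0,0,t))` of `μ_3 = ℤ/3` induced by `e` on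
`Π^tp_Ÿ = 0 × 0 × ℤ/3`, as a homomorphism. [cite: MochizukiEtTh2009, Cor 2.18(iv) p.61] -/
theorem psiHom_apply (e : P3 ≃* P3) (t : M3) :
    (q3.comp (e.toMonoidHom.comp ((MonoidHom.inr (Multiplicative ℤ) K3).comp (MonoidHom.inr M2 M3)))) t =
      q3 (e ((MonoidHom.inr (Multiplicative ℤ) K3).comp (MonoidHom.inr M2 M3) t)) := rfl

/-- `ψ_e ∘ ψ_{e⁻¹} = id` when `e` preserves `Π^tp_Y`. [cite: MochizukiEtTh2009, Cor 2.18(iv) p.61] -/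
theorem psiHom_psiHom_symm (e : P3 ≃* P3) (h : PiY.map e.toMonoidHom = PiY) (t : M3) :
    (q3.comp (e.toMonoidHom.comp ((MonoidHom.inr (Multiplicative ℤ) K3).comp (MonoidHom.inr M2 M3))))
      ((q3.comp (e.symm.toMonoidHom.comp
        ((MonoidHom.inr (Multiplicative ℤ) K3).comp (MonoidHom.inr M2 M3)))) t) = t := by
  rw [psiHom_apply, psiHom_apply,
    inr_inr_q3_of_mem (apply_mem_PiYdd e.symm (Subgroup.map_symm_eq_self_of_map_eq_self e PiY h)
      (inr_inr_mem_PiYdd t)), MulEquiv.apply_symm_apply]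
  rfl

/-- `ψ_{e⁻¹} ∘ ψ_e = id` when `e` preserves `Π^tp_Y`. [cite: MochizukiEtTh2009, Cor 2.18(iv) p.61] -/
theorem psiHom_symm_psiHom (e : P3 ≃* P3) (h : PiY.map e.toMonoidHom = PiY) (t : M3) :
    (q3.comp (e.symm.toMonoidHom.comp
        ((MonoidHom.inr (Multiplicative ℤ) K3).comp (MonoidHom.inr M2 M3))))
      ((q3.comp (e.toMonoidHom.comp
        ((MonoidHom.inr (Multiplicative ℤ) K3).comp (MonoidHom.inr M2 M3)))) t) = t := by
  have h' := psiHom_psiHom_symm e.symm (Subgroup.map_symm_eq_self_of_map_eq_self e PiY h) t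
  rw [MulEquiv.symm_symm] at h'
  exact h'

/-- **The lift of `γ`** (everything inlined, so that this file stays proof-only): for an automorphism
`γ` of the topological group `Π^tp_X` preserving `Π^tp_Y`, let `ψ_γ ∈ Aut(μ_3)` be the automorphism
through which `γ` acts on `Π^tp_Ÿ = 0 × 0 × ℤ/3 ≅ μ_3`; then `(u, y) ↦ (ψ_γ u, γ y)` is a bi-continuous
automorphism of the envelope `Π^tp_Y[μ_3] = μ_3 × Π^tp_Y` (trivial action, discrete) which maps
`Im(s^Θ_Ÿ)` onto itself (`η₀ = q₃` and `ψ_γ (q₃ y) = q₃ (γ y)` on `Π^tp_Ÿ`) and preserves `D_Y = 1` — an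
automorphism of the model mono-theta environment lying over `γ|_{Π^tp_Y}`.
[cite: MochizukiEtTh2009, Cor 2.18(iv) p.61] -/
theorem exists_iso_over (γ : P3 ≃ₜ* P3) (h : PiY.map γ.toMulEquiv.toMonoidHom = PiY) :
    ∃ α : (toy.modelMono eta0_mem).Iso (toy.modelMono eta0_mem),
      ∀ x : toy.env, ((CycEnvelope.proj toy.augY toy.chi (α.e x) : toy.PiY) : P3) =
        γ ((CycEnvelope.proj toy.augY toy.chi x : toy.PiY) : P3) := by
  -- the underlying group automorphism and the stability of `Π^tp_Y` under it and its inverse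
  have hY : PiY.map γ.toMulEquiv.toMonoidHom = PiY := h
  have hYs : PiY.map γ.toMulEquiv.symm.toMonoidHom = PiY :=
    Subgroup.map_symm_eq_self_of_map_eq_self γ.toMulEquiv PiY hY
  -- the coefficient automorphism `ψ_γ` of `μ_3`
  let ψ : M3 ≃* M3 := MonoidHom.toMulEquiv
    (q3.comp (γ.toMulEquiv.toMonoidHom.comp
      ((MonoidHom.inr (Multiplicative ℤ) K3).comp (MonoidHom.inr M2 M3))))
    (q3.comp (γ.toMulEquiv.symm.toMonoidHom.comp
      ((MonoidHom.inr (Multiplicative ℤ) K3).comp (MonoidHom.inr M2 M3))))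
    (MonoidHom.ext fun t => psiHom_symm_psiHom γ.toMulEquiv hY t)
    (MonoidHom.ext fun t => psiHom_psiHom_symm γ.toMulEquiv hY t)
  have hψ : ∀ {y : P3}, y ∈ PiYdd → ψ (q3 y) = q3 (γ y) := by
    intro y hy
    change q3 (γ.toMulEquiv ((MonoidHom.inr (Multiplicative ℤ) K3).comp (MonoidHom.inr M2 M3) (q3 y))) = _
    rw [inr_inr_q3_of_mem hy]
    rfl
  -- the restriction `γ|_{Π^tp_Y}` and the lift to the envelope
  let γY : toy.PiY ≃* toy.PiY := (γ.toMulEquiv.subgroupMap PiY).trans (MulEquiv.subgroupCongr hY)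
  haveI := discreteTopology_env
  let A : toy.env ≃ₜ* toy.env :=
    { SemidirectProduct.congr ψ γY (fun _ => MulEquiv.ext fun _ => rfl) with
      continuous_toFun := continuous_of_discreteTopology
      continuous_invFun := continuous_of_discreteTopology }
  -- `A (s^Θ y) = s^Θ (γ y)`
  have hAs : ∀ y : toy.PiYdd, A (toy.toThetaEnvData.sTheta eta0_mem y) =
      toy.toThetaEnvData.sTheta eta0_mem ⟨γ y, apply_mem_PiYdd γ.toMulEquiv hY y.2⟩ := by
    intro y
    refine SemidirectProduct.ext ?_ (Subtype.ext rfl)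
    change ψ (eta0 y)⁻¹ = (eta0 ⟨γ y, apply_mem_PiYdd γ.toMulEquiv hY y.2⟩)⁻¹
    rw [map_inv]
    exact congrArg _ (hψ y.2)
  -- hence `A` maps `Im(s^Θ_Ÿ)` onto itself
  have hrange : (toy.toThetaEnvData.sTheta eta0_mem).range.map A.toMulEquiv.toMonoidHom =
      (toy.toThetaEnvData.sTheta eta0_mem).range := by
    ext x
    constructor
    · rintro ⟨_, ⟨y, rfl⟩, rfl⟩
      exact ⟨⟨γ y, apply_mem_PiYdd γ.toMulEquiv hY y.2⟩, (hAs y).symm⟩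
    · rintro ⟨y, rfl⟩
      refine ⟨_, ⟨⟨γ.toMulEquiv.symm y, apply_mem_PiYdd γ.toMulEquiv.symm hYs y.2⟩, rfl⟩, ?_⟩
      change A _ = _
      rw [hAs]
      exact congrArg _ (Subtype.ext (γ.toMulEquiv.apply_symm_apply (y : P3)))
  refine ⟨{ e := A, map_D := ?_, map_sTheta := ?_ }, fun x => rfl⟩
  · change toy.DY.map _ = toy.DY
    rw [DY_eq_bot, Subgroup.map_bot]
  · change (fun H => H.map A.toMulEquiv.toMonoidHom) ''
        CycEnvelope.muConjClass _ _ (toy.toThetaEnvData.sTheta eta0_mem).range =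
      CycEnvelope.muConjClass _ _ (toy.toThetaEnvData.sTheta eta0_mem).range
    rw [muConjClass_eq_singleton, Set.image_singleton, Set.singleton_eq_singleton_iff]
    exact hrange

/-- **Cor. 2.18 (iv), surjectivity, HOLDS at the level-`3` toy**: every automorphism `γ` of the
topological group `Π^tp_X` preserving `Π^tp_Y` lifts to an automorphism of the model mono-theta
environment inducing `γ|_{Π^tp_Y}` (`exists_iso_over`). [cite: MochizukiEtTh2009, Cor 2.18(iv) p.61] -/
theorem cor218_iv_surjective :
    Literature.AnabelianGeometry.EtaleTheta.RigidData.Cor218_iv_surjective toy := by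
  intro η hη γ hγ
  have h1 : η = eta0 := hη
  subst h1
  exact exists_iso_over γ hγ

end ToyN3

end RigidData

/-! ## §3. The `ThetaEnvData`-level rows F-0638 / F-0639: universal closures REFUTED, instances PROVED -/

namespace ThetaEnvData

/-- **F-0638, universal closure REFUTED**: `ThetaEnvData.Cor218_iv_fibre` does NOT hold for every
`T : ThetaEnvData N` — at abc-iut-w5-d175's level-`3` toy (`RigidData.ToyN3.toy`, viewed as a
`ThetaEnvData 3`) the flip `(u, y) ↦ (u⁻¹·δ(y), y)` is a model automorphism over the identity of
`Π^tp_Y` inverting the cyclotome (transport of `RigidData.ToyN3.not_forall_cor218_iv_fibre` along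
`RigidData.cor218_iv_fibre_iff`). [cite: MochizukiEtTh2009, Cor 2.18(iv) p.61] -/
theorem not_forall_cor218_iv_fibre :
    ¬ ∀ (N : ℕ+) (T : ThetaEnvData.{0} N),
      Literature.AnabelianGeometry.EtaleTheta.ThetaEnvData.Cor218_iv_fibre T :=
  fun h => RigidData.ToyN3.not_forall_cor218_iv_fibre
    fun N _ R => (R.cor218_iv_fibre_iff).2 (h N R.toThetaEnvData)

/-- **F-0638, instance form PROVED**: the fibre clause holds at the level-`1` toy
(`RigidData.Toy.cor218_iv_fibre`). [cite: MochizukiEtTh2009, Cor 2.18(iv) p.61] -/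
theorem exists_cor218_iv_fibre :
    ∃ T : ThetaEnvData.{0} 1, Literature.AnabelianGeometry.EtaleTheta.ThetaEnvData.Cor218_iv_fibre T :=
  ⟨(RigidData.Toy.toy 1).toThetaEnvData,
    (RigidData.cor218_iv_fibre_iff _).1 (RigidData.Toy.cor218_iv_fibre 1)⟩

/-- **F-0638 verdict**: universal closure REFUTED ∧ instance form PROVED — the row is a genuine
hypothesis on the data `T`, dischargeable instance by instance (at the [EtTh] §1 model:
`DoubleUnderline.thetaEnvData_cor218_iv_fibre_of_origin`), never as a closed fact.
[cite: MochizukiEtTh2009, Cor 2.18(iv) p.61] -/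
theorem cor218_iv_fibre_schema_verdict :
    (¬ ∀ (N : ℕ+) (T : ThetaEnvData.{0} N),
        Literature.AnabelianGeometry.EtaleTheta.ThetaEnvData.Cor218_iv_fibre T) ∧
      ∃ T : ThetaEnvData.{0} 1,
        Literature.AnabelianGeometry.EtaleTheta.ThetaEnvData.Cor218_iv_fibre T :=
  ⟨not_forall_cor218_iv_fibre, exists_cor218_iv_fibre⟩

/-- **F-0639, universal closure REFUTED**: `ThetaEnvData.Cor218_iv_surjective` does NOT hold for every
`T : ThetaEnvData N` — at the level-`1` toy `id × swap(a,b)` preserves `Π^tp_Y` but moves `Π^tp_Ÿ`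
(transport of `RigidData.Toy.not_forall_cor218_iv_surjective` along `RigidData.cor218_iv_surjective_iff`).
[cite: MochizukiEtTh2009, Cor 2.18(iv) p.61] -/
theorem not_forall_cor218_iv_surjective :
    ¬ ∀ (N : ℕ+) (T : ThetaEnvData.{0} N),
      Literature.AnabelianGeometry.EtaleTheta.ThetaEnvData.Cor218_iv_surjective T :=
  fun h => RigidData.Toy.not_forall_cor218_iv_surjective
    fun N _ R => (R.cor218_iv_surjective_iff).2 (h N R.toThetaEnvData)

/-- **F-0639, instance form PROVED**: the surjectivity clause holds at the level-`3` toy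
(`RigidData.ToyN3.cor218_iv_surjective`). [cite: MochizukiEtTh2009, Cor 2.18(iv) p.61] -/
theorem exists_cor218_iv_surjective :
    ∃ T : ThetaEnvData.{0} 3,
      Literature.AnabelianGeometry.EtaleTheta.ThetaEnvData.Cor218_iv_surjective T :=
  ⟨RigidData.ToyN3.toy.toThetaEnvData,
    (RigidData.cor218_iv_surjective_iff _).1 RigidData.ToyN3.cor218_iv_surjective⟩

/-- **F-0639 verdict**: universal closure REFUTED ∧ instance form PROVED — a genuine hypothesis on
`T`, dischargeable instance by instance (at the [EtTh] §1 model at every level `M ∈ ℕ≥1`: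
`DoubleUnderline.thetaEnvData_cor218_iv_surjective_modAll`), never as a closed fact.
[cite: MochizukiEtTh2009, Cor 2.18(iv) p.61] -/
theorem cor218_iv_surjective_schema_verdict :
    (¬ ∀ (N : ℕ+) (T : ThetaEnvData.{0} N),
        Literature.AnabelianGeometry.EtaleTheta.ThetaEnvData.Cor218_iv_surjective T) ∧
      ∃ T : ThetaEnvData.{0} 3,
        Literature.AnabelianGeometry.EtaleTheta.ThetaEnvData.Cor218_iv_surjective T :=
  ⟨not_forall_cor218_iv_surjective, exists_cor218_iv_surjective⟩

end ThetaEnvData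

end Literature.AnabelianGeometry.EtaleTheta
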